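import Mathlib
import HarnessLib
import Summits.CriticalPhenomena.CardyFormulaZ2.Theorems.CardyMagicRigidityMagicFormulaTLoopReflection
import Summits.CriticalPhenomena.CardyFormulaZ2.Theorems.CardyMagicRigidityMagicFormulaTStubCellBridge
import Literature.Probability.Percolation.SiteNestingWeightBound
import Literature.Probability.Percolation.NestingWeightMeasurable

/-!
# Exact centring of the twisted nesting phases on `𝕋` (crux `MagicFormulaT`, line `Sketch`)

Crux `Summit.CriticalPhenomena.CardyFormulaZ2.Theses.CardyMagicRigidity.MagicFormulaT`
(stmt-CriticalPhenomena-4836), line `Sketch` — helper file 3/3, the identity itself. In the dense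
vocabulary of the registered skeleton (`Cruxes/MagicFormulaT/Lines/Sketch.lean`: unit lattice,
charges `λ_x` at sites, interiors read through winding numbers at the sites `triMeshPoint 1 x`):

**Theorem (`integral_finsum_phase_eq_zero`, sub-goal `denseCentring`; general form
`integral_finsum_phase_eq_zero_of_invariant` for any family of loops invariant under the point
reflections `z ↦ triEmbed c − z`, e.g. the loops of diameter `< η`).** For every Bernoulli parameter `p`, every finite set
of sites `S` and every NEUTRAL charge configuration `λ` (`Σ_{x ∈ S} λ_x = 0`),
`E_p[ Σ_{u interface loop of ω} θ_u ] = 0`, `θ_u = Σ_{x ∈ S : W(u, x) ≠ 0} λ_x`.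

So the twisted nesting transform `t ↦ E[∏_u 2cos(t θ_u + π/3)]` of the crux (`denseTransform`,
`stub_denseMagicT`) has no linear term at ANY mesh: the order-one case of the evenness that
`MagicFormulaT` forces in the limit (Disproof.lean F5) holds exactly on the lattice, and the linear
part of the small-loop centring hypothesis (T) of `CardyMagicRigidityTransferContinuityReduction`
is an identity, not an estimate. Proof:

* `phase_eq_sum_dipole`, `finsum_phase_eq_sum_ncard` — by neutrality,
  `θ_u = Σ_x λ_x (𝟙[x ∈ u, x₀ ∉ u] − 𝟙[x₀ ∈ u, x ∉ u])` for any base site `x₀`, so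
  `Σ_u θ_u = Σ_x λ_x (N_{x∖x₀} − N_{x₀∖x})` with `N_{x∖y}` the number of loops winding around `x` but
  not around `y` — finitely many, uniformly in `ω`: such a loop meets the segment `[x, y]`
  (`range_inter_segment_nonempty_of_wind_ne`), hence the ball containing it, and
  `ncard_loops_siteLoopConfig_meeting_le` applies (`sep_finite_ncard_le`);
* `integral_ncard_sep_symm` — `E_p N^T_{x∖y} = E_p N^T_{y∖x}` for any family `T` of loops invariant under the
  point reflections through half-lattice points: the point reflection through the midpoint
  of `x` and `y` preserves `P_p` and maps the loops around `x` not `y` of `ω` onto the loops around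
  `y` not `x` of the reflected configuration (`sep_reflect`, from `loops_siteLoopConfig_reflect` and
  `wind_imageOn_reflect`);
* measurability of the counts (`measurable_ncard_sep`) through the measurable finite product
  `∏ᶠ_{u ∈ N} 2 = 2^{#N}` of `NestingWeightMeasurable`, integrability by the uniform bound.

No definition is introduced (`sep[T, ω, x, y]` is a local notation); everything is proved from tree /
Mathlib material; no named fact is used.
-/

noncomputable section

namespace Summit.CriticalPhenomena.CardyFormulaZ2.Cruxes.MagicFormulaT.LineSketch

open MeasureTheory Set
open Literature.Probability.Percolation Literature.Probability.LatticeModels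

section Centring

open Literature.Probability.RandomPlanarGeometry Metric Finset
open scoped unitInterval

/-- The loops of `ω` on the unit lattice that belong to the family `T`, wind around the site `x`
and do not wind around the site `y` (local notation, not a definition). -/
local notation3 (prettyPrint := false) "sep[" T ", " ω ", " x ", " y "]" =>
  {u : UnbasedLoop ℂ | u ∈ (siteLoopConfig 1 ω).loops ∧ u ∈ (T : Set (UnbasedLoop ℂ)) ∧
    u.wind (triEmbed (x : Site 2)) ≠ 0 ∧ u.wind (triEmbed (y : Site 2)) = 0}

/-! ## Separating loops meet the segment, hence are finitely many -/

/-- A loop with different winding numbers about `a` and `b` meets the segment `[a, b]`. -/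
theorem range_inter_segment_nonempty_of_wind_ne (u : UnbasedLoop ℂ) {a b : ℂ}
    (h : u.wind a ≠ u.wind b) : (u.range ∩ segment ℝ a b).Nonempty := by
  by_contra hne
  rw [Set.not_nonempty_iff_eq_empty] at hne
  have hdisj : Disjoint (segment ℝ a b) u.range := by
    rw [Set.disjoint_iff_inter_eq_empty, Set.inter_comm, hne]
  exact h (unbasedLoop_wind_eq_of_isPreconnected u (convex_segment a b).isPreconnected hdisj
    (left_mem_segment ℝ a b) (right_mem_segment ℝ a b))

/-- The separating loops are among the loops meeting the closed ball about `0` containing both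
sites. -/
theorem sep_subset_meeting (T : Set (UnbasedLoop ℂ)) (ω : SiteConfig (Site 2)) (x y : Site 2) {R : ℝ}
    (hx : ‖triEmbed x‖ ≤ R) (hy : ‖triEmbed y‖ ≤ R) :
    sep[T, ω, x, y] ⊆ {u | u ∈ (siteLoopConfig 1 ω).loops ∧ (u.range ∩ closedBall (0 : ℂ) R).Nonempty} := by
  rintro u ⟨hu, -, hx0, hy0⟩
  refine ⟨hu, ?_⟩
  have hne : u.wind (triEmbed x) ≠ u.wind (triEmbed y) := by rw [hy0]; exact hx0
  obtain ⟨z, hzu, hzs⟩ := range_inter_segment_nonempty_of_wind_ne u hne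
  refine ⟨z, hzu, ?_⟩
  have hsub : segment ℝ (triEmbed x) (triEmbed y) ⊆ closedBall (0 : ℂ) R :=
    (convex_closedBall (0 : ℂ) R).segment_subset (mem_closedBall_zero_iff.2 hx)
      (mem_closedBall_zero_iff.2 hy)
  exact hsub hzs

/-- **The separating loops are finitely many, uniformly in `ω`**: at most the number `N(1, R)`
of faces with centre of norm `≤ R + 2`. -/
theorem sep_finite_ncard_le (T : Set (UnbasedLoop ℂ)) (ω : SiteConfig (Site 2)) (x y : Site 2) {R : ℝ}
    (hx : ‖triEmbed x‖ ≤ R) (hy : ‖triEmbed y‖ ≤ R) :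
    (sep[T, ω, x, y]).Finite ∧ (sep[T, ω, x, y]).ncard ≤
      (finite_setOf_norm_hexCenter_le one_pos (R + 2 * 1)).toFinset.card := by
  obtain ⟨hfin, hle⟩ := ncard_loops_siteLoopConfig_meeting_le one_pos R ω
  have hsub := sep_subset_meeting T ω x y hx hy
  exact ⟨hfin.subset hsub, (Set.ncard_le_ncard hsub hfin).trans hle⟩

/-! ## The reflection swaps the two families of separating loops -/

/-- **Under the point reflection through the midpoint of `x` and `y`, the loops of a
reflection-invariant family around `x` not `y` of `ω` become the loops of the family around `y`
not `x` of the reflected configuration.** -/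
theorem sep_reflect {T : Set (UnbasedLoop ℂ)} (ω : SiteConfig (Site 2)) (x y : Site 2)
    (hT : ∀ u, UnbasedLoop.imageOn (fun z ↦ triEmbed (x + y) - z) Set.univ u ∈ T ↔ u ∈ T) :
    sep[T, (Equiv.subLeft (x + y)) '' ω, y, x] =
      UnbasedLoop.imageOn (fun z ↦ triEmbed (x + y) - z) Set.univ '' sep[T, ω, x, y] := by
  ext u
  rw [mem_image_imageOn_reflect_iff]
  simp only [Set.mem_setOf_eq]
  rw [loops_siteLoopConfig_reflect, mem_image_imageOn_reflect_iff, hT u]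
  have hx : triEmbed x = triEmbed (x + y) - triEmbed y := by rw [triEmbed_add]; ring
  have hy : triEmbed y = triEmbed (x + y) - triEmbed x := by rw [triEmbed_add]; ring
  have h1 : (UnbasedLoop.imageOn (fun z ↦ triEmbed (x + y) - z) Set.univ u).wind (triEmbed x) =
      u.wind (triEmbed y) := by
    rw [hx, wind_imageOn_reflect]
  have h2 : (UnbasedLoop.imageOn (fun z ↦ triEmbed (x + y) - z) Set.univ u).wind (triEmbed y) =
      u.wind (triEmbed x) := by
    rw [hy, wind_imageOn_reflect]
  rw [← h1, ← h2]

/-- The two families of separating loops have the same cardinality after reflection. -/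
theorem ncard_sep_reflect {T : Set (UnbasedLoop ℂ)} (ω : SiteConfig (Site 2)) (x y : Site 2)
    (hT : ∀ u, UnbasedLoop.imageOn (fun z ↦ triEmbed (x + y) - z) Set.univ u ∈ T ↔ u ∈ T) :
    (sep[T, (Equiv.subLeft (x + y)) '' ω, y, x]).ncard = (sep[T, ω, x, y]).ncard := by
  rw [sep_reflect ω x y hT, Set.ncard_image_of_injective _ (imageOn_reflect_injective _)]

/-- **`E N_{x∖y} = E N_{y∖x}`**: within a reflection-invariant family, the expected numbers of
loops around `x` not `y` and around `y` not `x` agree, for every Bernoulli parameter (reflection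
invariance of `P_p`; no integrability needed). -/
theorem integral_ncard_sep_symm {T : Set (UnbasedLoop ℂ)} (p : unitInterval) (x y : Site 2)
    (hT : ∀ u, UnbasedLoop.imageOn (fun z ↦ triEmbed (x + y) - z) Set.univ u ∈ T ↔ u ∈ T) :
    ∫ ω, ((sep[T, ω, y, x]).ncard : ℝ) ∂(triSitePercolation p) =
      ∫ ω, ((sep[T, ω, x, y]).ncard : ℝ) ∂(triSitePercolation p) := by
  rw [← integral_comp_reflect (x + y) p (fun ω ↦ ((sep[T, ω, y, x]).ncard : ℝ))]
  simp only [ncard_sep_reflect _ x y hT]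

/-! ## Measurability and integrability of the counts -/

/-- `∏ᶠ_{u ∈ s} 2 = 2 ^ #s` for a finite set `s`. -/
theorem finprod_mem_two_eq_pow {s : Set (UnbasedLoop ℂ)} (hs : s.Finite) :
    ∏ᶠ u ∈ s, (2 : ℝ) = 2 ^ s.ncard := by
  rw [finprod_mem_eq_finite_toFinset_prod _ hs, Finset.prod_const, Set.ncard_eq_toFinset_card s hs]

/-- **The count of separating loops is a measurable function of the configuration** (through the
measurable finite product `∏ᶠ_{u ∈ sep} 2 = 2^{#sep}` of `NestingWeightMeasurable`). -/
theorem measurable_ncard_sep (T : Set (UnbasedLoop ℂ)) (x y : Site 2) :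
    Measurable fun ω : SiteConfig (Site 2) ↦ ((sep[T, ω, x, y]).ncard : ℝ) := by
  haveI := countable_sigma_hexLoop
  have hmeas : Measurable fun ω : SiteConfig (Site 2) ↦ ∏ᶠ u ∈ sep[T, ω, x, y], (2 : ℝ) :=
    measurable_finprod_mem_of_subset_range _
      (fun ω ↦ Set.Subset.trans (fun u hu ↦ hu.1) (loops_siteLoopConfig_subset_range 1 ω))
      (fun u ↦ (measurable_mem_loops_siteLoopConfig 1 u).and measurable_const) _
  have heq : (fun ω : SiteConfig (Site 2) ↦ ((sep[T, ω, x, y]).ncard : ℝ)) =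
      fun ω ↦ Real.log (∏ᶠ u ∈ sep[T, ω, x, y], (2 : ℝ)) / Real.log 2 := by
    funext ω
    obtain ⟨hfin, -⟩ := sep_finite_ncard_le T ω x y (le_max_left ‖triEmbed x‖ ‖triEmbed y‖)
      (le_max_right _ _)
    rw [finprod_mem_two_eq_pow hfin, Real.log_pow, mul_div_assoc,
      div_self (Real.log_pos one_lt_two).ne', mul_one]
  rw [heq]
  exact (Real.measurable_log.comp hmeas).div_const _

/-- The count of separating loops is integrable (bounded and measurable). -/
theorem integrable_ncard_sep (T : Set (UnbasedLoop ℂ)) (p : unitInterval) (x y : Site 2) :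
    Integrable (fun ω : SiteConfig (Site 2) ↦ ((sep[T, ω, x, y]).ncard : ℝ)) (triSitePercolation p) := by
  refine Integrable.of_mem_Icc 0
    ((finite_setOf_norm_hexCenter_le one_pos (max ‖triEmbed x‖ ‖triEmbed y‖ + 2 * 1)).toFinset.card : ℝ)
    (measurable_ncard_sep T x y).aemeasurable
    (Filter.Eventually.of_forall fun ω ↦ ⟨Nat.cast_nonneg _, ?_⟩)
  exact_mod_cast (sep_finite_ncard_le T ω x y (le_max_left _ _) (le_max_right _ _)).2

/-- **The dipole counts are centred** within a reflection-invariant family: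
`E[N_{x∖y} − N_{y∖x}] = 0`. -/
theorem integral_ncard_sep_sub_eq_zero {T : Set (UnbasedLoop ℂ)} (p : unitInterval) (x y : Site 2)
    (hT : ∀ u, UnbasedLoop.imageOn (fun z ↦ triEmbed (x + y) - z) Set.univ u ∈ T ↔ u ∈ T) :
    ∫ ω, (((sep[T, ω, x, y]).ncard : ℝ) - ((sep[T, ω, y, x]).ncard : ℝ)) ∂(triSitePercolation p) = 0 := by
  rw [integral_sub (integrable_ncard_sep T p x y) (integrable_ncard_sep T p y x),
    integral_ncard_sep_symm p x y hT, sub_self]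

/-! ## The phase sum as a combination of dipole counts -/

/-- One loop: the neutral phase is a combination of dipole indicators,
`Σ_x λ_x 𝟙[x ∈ u] = Σ_x λ_x (𝟙[x ∈ u, x₀ ∉ u] − 𝟙[x₀ ∈ u, x ∉ u])` when `Σ_x λ_x = 0`. -/
theorem phase_eq_sum_dipole (u : UnbasedLoop ℂ) (S : Finset (Site 2)) (lam : Site 2 → ℝ)
    (x₀ : Site 2) (h0 : ∑ x ∈ S, lam x = 0) :
    (∑ x ∈ S, if u.wind (triEmbed x) ≠ 0 then lam x else 0) =
      ∑ x ∈ S, lam x *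
        ((if u.wind (triEmbed x) ≠ 0 ∧ u.wind (triEmbed x₀) = 0 then (1 : ℝ) else 0) -
          (if u.wind (triEmbed x₀) ≠ 0 ∧ u.wind (triEmbed x) = 0 then (1 : ℝ) else 0)) := by
  have key : ∀ x, (if u.wind (triEmbed x) ≠ 0 then lam x else 0) =
      lam x * ((if u.wind (triEmbed x) ≠ 0 ∧ u.wind (triEmbed x₀) = 0 then (1 : ℝ) else 0) -
        (if u.wind (triEmbed x₀) ≠ 0 ∧ u.wind (triEmbed x) = 0 then (1 : ℝ) else 0)) +
        lam x * (if u.wind (triEmbed x₀) ≠ 0 then (1 : ℝ) else 0) := by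
    intro x
    rcases eq_or_ne (u.wind (triEmbed x)) 0 with ha | ha <;>
      rcases eq_or_ne (u.wind (triEmbed x₀)) 0 with hb | hb <;> simp [ha, hb]
  simp_rw [key]
  rw [Finset.sum_add_distrib, ← Finset.sum_mul, h0, zero_mul, add_zero]

/-- **The neutral phase sum of a configuration over a family of loops is a combination of dipole
counts**: `Σ_{u ∈ T} θ_u = Σ_x λ_x (N^T_{x∖x₀} − N^T_{x₀∖x})`, an identity between finite sums (only
the finitely many loops meeting a ball containing the sites contribute). -/
theorem finsum_phase_eq_sum_ncard (T : Set (UnbasedLoop ℂ)) (ω : SiteConfig (Site 2))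
    (S : Finset (Site 2)) (lam : Site 2 → ℝ) (x₀ : Site 2) (h0 : ∑ x ∈ S, lam x = 0) :
    (∑ᶠ u ∈ (siteLoopConfig 1 ω).loops ∩ T, ∑ x ∈ S, if u.wind (triEmbed x) ≠ 0 then lam x else 0) =
      ∑ x ∈ S, lam x * (((sep[T, ω, x, x₀]).ncard : ℝ) - ((sep[T, ω, x₀, x]).ncard : ℝ)) := by
  classical
  -- a ball containing all the sites
  set R : ℝ := ∑ x ∈ insert x₀ S, ‖triEmbed x‖ with hR
  have hRx : ∀ x ∈ insert x₀ S, ‖triEmbed x‖ ≤ R := fun x hx ↦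
    Finset.single_le_sum (f := fun x ↦ ‖triEmbed x‖) (fun _ _ ↦ norm_nonneg _) hx
  have hR0 : ‖triEmbed x₀‖ ≤ R := hRx x₀ (mem_insert_self _ _)
  have hRS : ∀ x ∈ S, ‖triEmbed x‖ ≤ R := fun x hx ↦ hRx x (mem_insert_of_mem hx)
  -- the finite set of loops of the family meeting it
  obtain ⟨hMfin, -⟩ := ncard_loops_siteLoopConfig_meeting_le one_pos R ω
  set M : Finset (UnbasedLoop ℂ) := hMfin.toFinset.filter (· ∈ T) with hM
  have hmemM : ∀ u, u ∈ (↑M : Set (UnbasedLoop ℂ)) ↔ (u ∈ (siteLoopConfig 1 ω).loops ∧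
      (u.range ∩ closedBall (0 : ℂ) R).Nonempty) ∧ u ∈ T := fun u ↦ by
    rw [hM, Finset.coe_filter, Set.mem_setOf_eq, Set.Finite.mem_toFinset, Set.mem_setOf_eq]
  have hMsub : (↑M : Set (UnbasedLoop ℂ)) ⊆ (siteLoopConfig 1 ω).loops ∩ T := fun u hu ↦
    ⟨((hmemM u).1 hu).1.1, ((hmemM u).1 hu).2⟩
  -- the phase sum is a sum over `M`
  have hsupp : ((siteLoopConfig 1 ω).loops ∩ T) ∩ Function.support
      (fun u ↦ ∑ x ∈ S, if u.wind (triEmbed x) ≠ 0 then lam x else 0) ⊆ ↑M := by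
    rintro u ⟨⟨hu, huT⟩, hne⟩
    rw [hmemM]
    refine ⟨⟨hu, ?_⟩, huT⟩
    by_contra hdisj
    rw [Set.not_nonempty_iff_eq_empty] at hdisj
    have hdisj' : Disjoint (closedBall (0 : ℂ) R) u.range := by
      rw [Set.disjoint_iff_inter_eq_empty, Set.inter_comm, hdisj]
    -- the winding number is constant on the ball, so the phase is `𝟙 · Σ λ = 0`
    have hconst : ∀ x ∈ S, u.wind (triEmbed x) = u.wind (triEmbed x₀) := fun x hx ↦
      unbasedLoop_wind_eq_of_isPreconnected u (convex_closedBall (0 : ℂ) R).isPreconnected hdisj'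
        (mem_closedBall_zero_iff.2 (hRS x hx)) (mem_closedBall_zero_iff.2 hR0)
    apply hne
    change (∑ x ∈ S, if u.wind (triEmbed x) ≠ 0 then lam x else 0) = 0
    have hsum : (∑ x ∈ S, if u.wind (triEmbed x) ≠ 0 then lam x else 0) =
        ∑ x ∈ S, if u.wind (triEmbed x₀) ≠ 0 then lam x else 0 :=
      Finset.sum_congr rfl fun x hx ↦ by rw [hconst x hx]
    rw [hsum]
    rcases eq_or_ne (u.wind (triEmbed x₀)) 0 with h | h
    · simp [h]
    · simp [h, h0]
  rw [finsum_mem_eq_sum_of_subset _ hsupp hMsub]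
  -- rewrite each phase as a combination of dipole indicators and swap the sums
  simp_rw [phase_eq_sum_dipole _ S lam x₀ h0]
  rw [Finset.sum_comm]
  refine Finset.sum_congr rfl fun x hx ↦ ?_
  rw [← Finset.mul_sum, Finset.sum_sub_distrib]
  have hfilter : ∀ a b : Site 2, ‖triEmbed a‖ ≤ R → ‖triEmbed b‖ ≤ R →
      sep[T, ω, a, b] = ↑(M.filter fun u ↦ u.wind (triEmbed a) ≠ 0 ∧ u.wind (triEmbed b) = 0) := by
    intro a b ha hb
    rw [Finset.coe_filter]
    ext u
    constructor
    · intro hu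
      have huM : u ∈ (↑M : Set (UnbasedLoop ℂ)) := by
        rw [hmemM]; exact ⟨sep_subset_meeting T ω a b ha hb hu, hu.2.1⟩
      exact ⟨huM, hu.2.2⟩
    · rintro ⟨huM, hu⟩
      exact ⟨(hMsub huM).1, (hMsub huM).2, hu⟩
  congr 2
  · rw [Finset.sum_boole, hfilter x x₀ (hRS x hx) hR0, Set.ncard_coe_finset]
  · rw [Finset.sum_boole, hfilter x₀ x hR0 (hRS x hx), Set.ncard_coe_finset]

/-! ## The exact centring identities -/

/-- **EXACT CENTRING within a reflection-invariant family of loops (unit lattice, every Bernoulli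
parameter).** If the family `T` of unbased loops is invariant under every point reflection of `ℂ`
through a half-lattice point (`z ↦ triEmbed c − z`, `c ∈ ℤ²`) — e.g. all loops, or the loops of
diameter `< η` — then for every finite neutral charge configuration `λ` on sites of `𝕋`,
`E_p[Σ_{u interface loop, u ∈ T} Σ_{x : W(u, x) ≠ 0} λ_x] = 0`.
Proof: `θ_u = Σ_x λ_x(𝟙[x ∈ u, x₀ ∉ u] − 𝟙[x₀ ∈ u, x ∉ u])` by neutrality, and
`E N^T_{x∖x₀} = E N^T_{x₀∖x}` by the point reflection of `𝕋` through the midpoint of `x` and `x₀`. -/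
theorem integral_finsum_phase_eq_zero_of_invariant {T : Set (UnbasedLoop ℂ)}
    (hT : ∀ (c : Site 2) (u : UnbasedLoop ℂ),
      UnbasedLoop.imageOn (fun z ↦ triEmbed c - z) Set.univ u ∈ T ↔ u ∈ T)
    (p : unitInterval) (S : Finset (Site 2)) (lam : Site 2 → ℝ) (h0 : ∑ x ∈ S, lam x = 0) :
    ∫ ω, (∑ᶠ u ∈ (siteLoopConfig 1 ω).loops ∩ T,
        ∑ x ∈ S, if u.wind (triMeshPoint 1 x) ≠ 0 then lam x else 0) ∂(triSitePercolation p) = 0 := by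
  have hmesh : ∀ x : Site 2, triMeshPoint 1 x = triEmbed x := fun x ↦ by
    rw [triMeshPoint, Complex.ofReal_one, one_mul]
  simp_rw [hmesh]
  rcases S.eq_empty_or_nonempty with rfl | ⟨x₀, -⟩
  · simp
  simp_rw [finsum_phase_eq_sum_ncard T _ S lam x₀ h0]
  rw [integral_finsetSum]
  · refine Finset.sum_eq_zero fun x _ ↦ ?_
    rw [integral_const_mul, integral_ncard_sep_sub_eq_zero p x x₀ (hT (x + x₀)), mul_zero]
  · intro x _
    exact ((integrable_ncard_sep T p x x₀).sub (integrable_ncard_sep T p x₀ x)).const_mul (lam x)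

/-- **EXACT CENTRING (unit lattice, all interface loops, every Bernoulli parameter).** For every
finite neutral charge configuration `λ` on sites of `𝕋` (`Σ_x λ_x = 0`), the expected total phase
of the interface loops vanishes identically:
`E_p[Σ_{u interface loop} Σ_{x : W(u, x) ≠ 0} λ_x] = 0`.
Hence the twisted nesting transform `E[∏_u 2cos(t θ_u + π/3)]` has no linear term in `t` at any
mesh — the order-one case of the evenness that `MagicFormulaT` forces in the limit (Disproof F5),
holding EXACTLY on the lattice. -/
theorem integral_finsum_phase_eq_zero (p : unitInterval) (S : Finset (Site 2)) (lam : Site 2 → ℝ)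
    (h0 : ∑ x ∈ S, lam x = 0) :
    ∫ ω, (∑ᶠ u ∈ (siteLoopConfig 1 ω).loops,
        ∑ x ∈ S, if u.wind (triMeshPoint 1 x) ≠ 0 then lam x else 0) ∂(triSitePercolation p) = 0 := by
  have h := integral_finsum_phase_eq_zero_of_invariant (T := Set.univ)
    (fun _ _ ↦ by simp only [Set.mem_univ]) p S lam h0
  simp only [Set.inter_univ] at h
  exact h

/-! ## Truncated families: big loops and small loops -/

/-- The point reflections preserve the diameter of the trace of an unbased loop. -/
theorem diam_range_imageOn_reflect (q : ℂ) (u : UnbasedLoop ℂ) :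
    Metric.diam (UnbasedLoop.imageOn (fun z ↦ q - z) Set.univ u).range = Metric.diam u.range := by
  rw [UnbasedLoop.range_imageOn (by fun_prop) (Set.subset_univ _)]
  have hiso : Isometry fun z : ℂ ↦ q - z := Isometry.of_dist_eq fun a b ↦ by
    rw [dist_eq_norm, dist_eq_norm, sub_sub_sub_cancel_left, norm_sub_rev]
  exact hiso.diam_image u.range

/-- **EXACT CENTRING over the big loops** (trace-diameter `≥ η`, the loops kept by the truncated
nesting transform `truncNestingWeight`): for neutral charges,
`E_p[Σ_{u : diam u ≥ η} θ_u] = 0` on the unit lattice. -/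
theorem integral_finsum_phase_bigLoops_eq_zero (η : ℝ) (p : unitInterval) (S : Finset (Site 2))
    (lam : Site 2 → ℝ) (h0 : ∑ x ∈ S, lam x = 0) :
    ∫ ω, (∑ᶠ u ∈ (siteLoopConfig 1 ω).bigLoops η,
        ∑ x ∈ S, if u.wind (triMeshPoint 1 x) ≠ 0 then lam x else 0) ∂(triSitePercolation p) = 0 := by
  have hbig : ∀ ω : SiteConfig (Site 2), (siteLoopConfig 1 ω).bigLoops η =
      (siteLoopConfig 1 ω).loops ∩ {u | η ≤ Metric.diam u.range} := fun ω ↦ by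
    ext u; rw [LoopConfig.mem_bigLoops_iff]; rfl
  simp_rw [hbig]
  exact integral_finsum_phase_eq_zero_of_invariant
    (fun c u ↦ by simp only [Set.mem_setOf_eq, diam_range_imageOn_reflect]) p S lam h0

/-- **EXACT CENTRING over the small loops** (trace-diameter `< η`, the loops DROPPED by the
truncated nesting transform): for neutral charges, `E_p[Σ_{u : diam u < η} θ_u] = 0` on the unit
lattice — the linear part of the small-loop centring hypothesis (T) of
`CardyMagicRigidityTransferContinuityReduction` is an identity. -/
theorem integral_finsum_phase_smallLoops_eq_zero (η : ℝ) (p : unitInterval) (S : Finset (Site 2))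
    (lam : Site 2 → ℝ) (h0 : ∑ x ∈ S, lam x = 0) :
    ∫ ω, (∑ᶠ u ∈ (siteLoopConfig 1 ω).loops ∩ {u | Metric.diam u.range < η},
        ∑ x ∈ S, if u.wind (triMeshPoint 1 x) ≠ 0 then lam x else 0) ∂(triSitePercolation p) = 0 :=
  integral_finsum_phase_eq_zero_of_invariant
    (fun c u ↦ by simp only [Set.mem_setOf_eq, diam_range_imageOn_reflect]) p S lam h0

/-- **Sub-goal `denseCentring` — EXACT CENTRING (line `Sketch`, crux `MagicFormulaT`).** For every
Bernoulli parameter `p`, every finite set of sites `S` and every neutral charge configuration `λ`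
on it, `E_p[Σ_{u interface loop of 𝕋} Σ_{x ∈ S : W(u, x) ≠ 0} λ_x] = 0` on the unit lattice: the
dense twisted nesting transform of `stub_denseMagicT` has no linear term, at every mesh. -/
theorem denseCentring : ∀ (p : unitInterval) (S : Finset (Site 2)) (lam : Site 2 → ℝ),
    ∑ x ∈ S, lam x = 0 →
      ∫ ω, (∑ᶠ u ∈ (siteLoopConfig 1 ω).loops,
        ∑ x ∈ S, if u.wind (triMeshPoint 1 x) ≠ 0 then lam x else 0) ∂(triSitePercolation p) = 0 :=
  integral_finsum_phase_eq_zero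

end Centring

end Summit.CriticalPhenomena.CardyFormulaZ2.Cruxes.MagicFormulaT.LineSketch

end
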